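import Mathlib.Data.Finset.Card
import Mathlib.Data.Finset.Erase
import Mathlib.Algebra.BigOperators.Group.Finset.Sigma
import Mathlib.Algebra.BigOperators.Group.Finset.Piecewise
import Mathlib.Algebra.Order.BigOperators.Group.Finset
import Mathlib.Algebra.Group.Action.Defs
import HarnessLib

/-!
# The three-star triangle budget and the slot double count — hand steps of N7F §3.24 (c′)(d)

Cell `pub-hsemireg`, widening group W5, seat w5-n7-1 (gen 10); files of record
`widen/W5/N7-FEASIBILITY-w5n7.md` (N7F) §3.24 and `widen/W5/TABLE-W5-N7.md` row N7-38 (c)(g). HONEST FRAMING: pure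
finite counting. (§1) For a finite family of objects `i` each supported on a 2-element set `supp i` of
coordinates («missing hub→deuce slots», support = the two stars involved), the support-weighted FACE SUM IDENTITY
and the «one level down» double count of §3.24 (d): on a 4-face with at most two such objects the four co-faces
cannot all contain at least two of them (`2·d ≤ 4 < 8`). (§2) For a finite set `Tri` of triangles `(α, β, γ)` of
a triple (x, y, w) whose x- and y-vertices are heavy levels (hub or one of two deuces — the light-level lemma),
with at most two triangles through each x-deuce and pairwise distinct x-vertices among the triangles through each
y-deuce (the slice test (D) at margin-2 vertices), the number of triangles is at most `6 +` the number of
hub–hub triangles: LEMMA (THREE-STAR TRIANGLE BUDGET) of §3.24 (c′), `T₄ ≤ 6 + T_hh`. The light-level lemma, the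
slice test and every machine fact ((L1″) «HD-defect ≤ 2», «T₁ UNSAT») are NOT formalised: they enter as the
hypotheses named in each statement. Nothing here is a statement about any variety, sheaf or class, and nothing
here bears on HC / HC_CM / HC_AV.

* `sum_card_filter_supp_subset_erase` — `∑_{z ∈ S} #{i ∈ M | supp i ⊆ S.erase z} = (#S − 2) · #{i ∈ M | supp i ⊆ S}`.
* `false_of_three_faces_two_le` — §3.24 (d): `#S = 4`, at most two objects inside `S`, every co-face holds ≥ 2 ⇒ False.
* `card_triangles_le_six_add` — §3.24 (c′): `#Tri ≤ 6 + #{hub–hub triangles}`.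
* `card_triangles_le_six` — its corollary (i): no hub–hub triangle ⇒ `#Tri ≤ 6` (next to four stars some star pair is
  hub–hub-free, so `T₄ ≤ 6`).
* `card_triangles_le_six_add_of_sliceTest` — the same bound with the light-level lemma and the margin-2 matching DERIVED
  inside the file from the slice test (D) (two clauses) and the star-type margins into w: inputs = (D) + LEMMA-U margins only.
-/

open Finset

namespace Summit.Ventures.HSemireg.StarFamilyTriangleBudget

section Slots

variable {ι V : Type*} [DecidableEq V]

/-- The objects supported inside the co-face `S.erase z` are those supported inside `S` whose support misses
`z`. -/
theorem filter_supp_subset_erase (M : Finset ι) (supp : ι → Finset V) (S : Finset V) (z : V) :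
    {i ∈ M | supp i ⊆ S.erase z} = {i ∈ M | supp i ⊆ S ∧ z ∉ supp i} := by
  ext i
  simp only [mem_filter, subset_erase]

/-- **SUPPORT-WEIGHTED FACE SUM IDENTITY.** If every object of `M` is supported on exactly two coordinates, then
summing over the co-faces `S.erase z`, `z ∈ S`, the numbers of objects supported inside them gives
`(#S − 2) · #{i ∈ M | supp i ⊆ S}` (an object supported inside `S` survives in exactly the `#S − 2` co-faces
off its support). -/
theorem sum_card_filter_supp_subset_erase (M : Finset ι) (supp : ι → Finset V)
    (hM : ∀ i ∈ M, (supp i).card = 2) (S : Finset V) :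
    ∑ z ∈ S, #{i ∈ M | supp i ⊆ S.erase z} = (S.card - 2) * #{i ∈ M | supp i ⊆ S} := by
  calc ∑ z ∈ S, #{i ∈ M | supp i ⊆ S.erase z}
      = ∑ z ∈ S, ∑ i ∈ M with supp i ⊆ S, (if z ∉ supp i then 1 else 0) := by
        refine sum_congr rfl fun z _ => ?_
        rw [filter_supp_subset_erase, ← filter_filter, card_filter]
    _ = ∑ i ∈ M with supp i ⊆ S, ∑ z ∈ S, (if z ∉ supp i then 1 else 0) := sum_comm
    _ = ∑ i ∈ M with supp i ⊆ S, (S.card - 2) := by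
        refine sum_congr rfl fun i hi => ?_
        rw [mem_filter] at hi
        rw [← card_filter, ← sdiff_eq_filter, card_sdiff_of_subset hi.2, hM i hi.1]
    _ = (S.card - 2) * #{i ∈ M | supp i ⊆ S} := by
        rw [sum_const, smul_eq_mul, mul_comm]

/-- **N7F §3.24 (d), the double count «one level down».** On a 4-face `S` inside which at most two objects are
supported (in the cell: the star⁴ face of an ∅-class design misses `d ≤ 2` hub→deuce slots, rung (L1″)), the four
co-faces `S.erase z` cannot each contain at least two of them (in the cell: «T₁ UNSAT for μ» = every (star³, μ)
face misses ≥ 2 slots): the face sum identity would give `8 ≤ 2·d ≤ 4`. -/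
theorem false_of_three_faces_two_le (M : Finset ι) (supp : ι → Finset V)
    (hM : ∀ i ∈ M, (supp i).card = 2) {S : Finset V} (hS : S.card = 4)
    (hd : #{i ∈ M | supp i ⊆ S} ≤ 2) (h3 : ∀ z ∈ S, 2 ≤ #{i ∈ M | supp i ⊆ S.erase z}) :
    False := by
  have hsum := sum_card_filter_supp_subset_erase M supp hM S
  have hge : S.card * 2 ≤ ∑ z ∈ S, #{i ∈ M | supp i ⊆ S.erase z} :=
    card_nsmul_le_sum S _ 2 h3 |>.trans_eq' (by rw [smul_eq_mul])
  rw [hsum, hS] at hge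
  omega

end Slots

section Triangles

variable {X Y W : Type*} [DecidableEq X] [DecidableEq Y] [DecidableEq W]

/-- **LEMMA (THREE-STAR TRIANGLE BUDGET), N7F §3.24 (c′).** Let `Tri` be a finite set of triangles `(α, β, γ)` of
a coordinate triple (x, y, w), x and y of star type with hub `hx` resp. `hy` and deuces `dx, dx'` resp.
`dy, dy'`. Assume: (1) every triangle has its x-vertex in `{hx, dx, dx'}` and its y-vertex in `{hy, dy, dy'}`
(the light-level lemma: no triangle through a margin-1 level); (2x) through each x-deuce pass at most two
triangles, and (2y) the triangles through each y-deuce have pairwise distinct x-vertices (both are the slice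
test (D) at a margin-2 vertex: the triangles at a deuce form a partial matching). Then the number of triangles
is at most `6 +` the number of hub–hub triangles `(hx, hy, γ)`: the non-hub–hub triangles either have an
x-deuce as x-vertex (≤ 2 + 2) or have x-vertex `hx` and a y-deuce as y-vertex (≤ 1 + 1). -/
theorem card_triangles_le_six_add (Tri : Finset (X × Y × W)) (hx dx dx' : X) (hy dy dy' : Y)
    (hheavy : ∀ t ∈ Tri, (t.1 = hx ∨ t.1 = dx ∨ t.1 = dx') ∧ (t.2.1 = hy ∨ t.2.1 = dy ∨ t.2.1 = dy'))
    (h2x : ∀ δ, δ = dx ∨ δ = dx' → #{t ∈ Tri | t.1 = δ} ≤ 2)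
    (h2y : ∀ δ, δ = dy ∨ δ = dy' →
      ∀ t ∈ Tri, ∀ t' ∈ Tri, t.2.1 = δ → t'.2.1 = δ → t.1 = t'.1 → t = t') :
    #Tri ≤ 6 + #{t ∈ Tri | t.1 = hx ∧ t.2.1 = hy} := by
  -- through a y-deuce at most one triangle has x-vertex `hx`
  have hone : ∀ δ, δ = dy ∨ δ = dy' → #{t ∈ Tri | t.1 = hx ∧ t.2.1 = δ} ≤ 1 := by
    intro δ hδ
    rw [card_le_one]
    intro t ht t' ht'
    rw [mem_filter] at ht ht'
    exact h2y δ hδ t ht.1 t' ht'.1 ht.2.2 ht'.2.2 (ht.2.1.trans ht'.2.1.symm)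
  -- split `Tri` by the type of the x- and y-vertex
  have hcover : Tri ⊆ {t ∈ Tri | t.1 = hx ∧ t.2.1 = hy} ∪
      (({t ∈ Tri | t.1 = dx} ∪ {t ∈ Tri | t.1 = dx'}) ∪
       ({t ∈ Tri | t.1 = hx ∧ t.2.1 = dy} ∪ {t ∈ Tri | t.1 = hx ∧ t.2.1 = dy'})) := by
    intro t ht
    obtain ⟨hα, hβ⟩ := hheavy t ht
    simp only [mem_union, mem_filter]
    rcases hα with hα | hα | hα
    · rcases hβ with hβ | hβ | hβ
      · exact Or.inl ⟨ht, hα, hβ⟩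
      · exact Or.inr (Or.inr (Or.inl ⟨ht, hα, hβ⟩))
      · exact Or.inr (Or.inr (Or.inr ⟨ht, hα, hβ⟩))
    · exact Or.inr (Or.inl (Or.inl ⟨ht, hα⟩))
    · exact Or.inr (Or.inl (Or.inr ⟨ht, hα⟩))
  have h1 := h2x dx (Or.inl rfl)
  have h2 := h2x dx' (Or.inr rfl)
  have h3 := hone dy (Or.inl rfl)
  have h4 := hone dy' (Or.inr rfl)
  calc #Tri ≤ #({t ∈ Tri | t.1 = hx ∧ t.2.1 = hy} ∪
      (({t ∈ Tri | t.1 = dx} ∪ {t ∈ Tri | t.1 = dx'}) ∪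
       ({t ∈ Tri | t.1 = hx ∧ t.2.1 = dy} ∪ {t ∈ Tri | t.1 = hx ∧ t.2.1 = dy'}))) := card_le_card hcover
    _ ≤ #{t ∈ Tri | t.1 = hx ∧ t.2.1 = hy} +
      ((#{t ∈ Tri | t.1 = dx} + #{t ∈ Tri | t.1 = dx'}) +
       (#{t ∈ Tri | t.1 = hx ∧ t.2.1 = dy} + #{t ∈ Tri | t.1 = hx ∧ t.2.1 = dy'})) := by
        refine (card_union_le _ _).trans (Nat.add_le_add_left ?_ _)
        refine (card_union_le _ _).trans (Nat.add_le_add ?_ ?_)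
        · exact card_union_le _ _
        · exact card_union_le _ _
    _ ≤ 6 + #{t ∈ Tri | t.1 = hx ∧ t.2.1 = hy} := by omega

/-- **Corollary (i) of §3.24 (c′).** If in addition NO triangle is of hub–hub type `(hx, hy, γ)` (the star pair
(x, y) carries no hub–hub torus — next to four stars some star pair is hub–hub-free, N7F §3.10 (p)), then there
are at most six triangles: `T₄ ≤ 6`. -/
theorem card_triangles_le_six (Tri : Finset (X × Y × W)) (hx dx dx' : X) (hy dy dy' : Y)
    (hheavy : ∀ t ∈ Tri, (t.1 = hx ∨ t.1 = dx ∨ t.1 = dx') ∧ (t.2.1 = hy ∨ t.2.1 = dy ∨ t.2.1 = dy'))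
    (h2x : ∀ δ, δ = dx ∨ δ = dx' → #{t ∈ Tri | t.1 = δ} ≤ 2)
    (h2y : ∀ δ, δ = dy ∨ δ = dy' →
      ∀ t ∈ Tri, ∀ t' ∈ Tri, t.2.1 = δ → t'.2.1 = δ → t.1 = t'.1 → t = t')
    (hhh : ∀ t ∈ Tri, ¬ (t.1 = hx ∧ t.2.1 = hy)) :
    #Tri ≤ 6 := by
  have h := card_triangles_le_six_add Tri hx dx dx' hy dy dy' hheavy h2x h2y
  have h0 : #{t ∈ Tri | t.1 = hx ∧ t.2.1 = hy} = 0 := by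
    rw [card_eq_zero, filter_eq_empty_iff]
    exact hhh
  omega


/-- **LEMMA (THREE-STAR TRIANGLE BUDGET) from the slice test itself.** The triple (x, y, w) is given by its three
torus sets `Exy`, `Exw`, `Eyw` (a torus = a pair of levels) and `Tri` is its set of triangles (`hTri`). The
coordinates x and y are of star type as seen from w: apart from a hub (`hx` resp. `hy`) and two deuces
(`dx, dx'` resp. `dy, dy'`, each with at most two tori into w, and `dx, dx'` with at most two tori into y) every
level sends at most one torus into w (`hxl`, `hxd`, `hyl`, `hyd` — LEMMA-U margins (6,2,2,1¹⁰)). The slice test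
(D) of N7F §3.9 (a) is assumed in the two clauses the hand proof uses: at every x-level `α`, for the pair (y, w),
no y-neighbour `β` of `α` closes triangles with ALL w-neighbours of `α` (`hDx`); at every y-level `β`, for the
pair (x, w), no x-neighbour `α` of `β` closes triangles with all w-neighbours of `β` (`hDy`). CONSEQUENCES derived
inside the proof: no triangle through a margin-1 level (the LIGHT-LEVEL LEMMA, §3.7 (b)); at most two triangles
through an x-deuce and pairwise distinct x-vertices through a y-deuce (the margin-2 instance of (D)); hence, by
`card_triangles_le_six_add`, **`#Tri ≤ 6 + #{hub–hub triangles}`** — N7F §3.24 (c′) with inputs (D) + margins only. -/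
theorem card_triangles_le_six_add_of_sliceTest
    (Exy : Finset (X × Y)) (Exw : Finset (X × W)) (Eyw : Finset (Y × W)) (Tri : Finset (X × Y × W))
    (hTri : ∀ t, t ∈ Tri ↔ (t.1, t.2.1) ∈ Exy ∧ (t.1, t.2.2) ∈ Exw ∧ (t.2.1, t.2.2) ∈ Eyw)
    (hx dx dx' : X) (hy dy dy' : Y)
    (hxl : ∀ α, α ≠ hx → α ≠ dx → α ≠ dx' → #{e ∈ Exw | e.1 = α} ≤ 1)
    (hxd : ∀ δ, δ = dx ∨ δ = dx' → #{e ∈ Exy | e.1 = δ} ≤ 2 ∧ #{e ∈ Exw | e.1 = δ} ≤ 2)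
    (hyl : ∀ β, β ≠ hy → β ≠ dy → β ≠ dy' → #{e ∈ Eyw | e.1 = β} ≤ 1)
    (hyd : ∀ δ, δ = dy ∨ δ = dy' → #{e ∈ Eyw | e.1 = δ} ≤ 2)
    (hDx : ∀ α β, (α, β) ∈ Exy → ∃ γ, (α, γ) ∈ Exw ∧ (β, γ) ∉ Eyw)
    (hDy : ∀ α β, (α, β) ∈ Exy → ∃ γ, (β, γ) ∈ Eyw ∧ (α, γ) ∉ Exw) :
    #Tri ≤ 6 + #{t ∈ Tri | t.1 = hx ∧ t.2.1 = hy} := by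
  -- LIGHT-LEVEL LEMMA at x: a level with ≤ 1 torus into w lies on no triangle
  have hLLx : ∀ t ∈ Tri, #{e ∈ Exw | e.1 = t.1} ≤ 1 → False := by
    intro t ht h1
    obtain ⟨hxy, hxw, hyw⟩ := (hTri t).1 ht
    obtain ⟨γ, hγ, hβγ⟩ := hDx t.1 t.2.1 hxy
    have heq : (t.1, t.2.2) = (t.1, γ) :=
      card_le_one.1 h1 _ (mem_filter.2 ⟨hxw, rfl⟩) _ (mem_filter.2 ⟨hγ, rfl⟩)
    rw [Prod.mk.injEq] at heq
    exact hβγ (heq.2 ▸ hyw)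
  -- LIGHT-LEVEL LEMMA at y
  have hLLy : ∀ t ∈ Tri, #{e ∈ Eyw | e.1 = t.2.1} ≤ 1 → False := by
    intro t ht h1
    obtain ⟨hxy, hxw, hyw⟩ := (hTri t).1 ht
    obtain ⟨γ, hγ, hαγ⟩ := hDy t.1 t.2.1 hxy
    have heq : (t.2.1, t.2.2) = (t.2.1, γ) :=
      card_le_one.1 h1 _ (mem_filter.2 ⟨hyw, rfl⟩) _ (mem_filter.2 ⟨hγ, rfl⟩)
    rw [Prod.mk.injEq] at heq
    exact hαγ (heq.2 ▸ hxw)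
  -- (1) heavy vertices only
  have hheavy : ∀ t ∈ Tri, (t.1 = hx ∨ t.1 = dx ∨ t.1 = dx') ∧ (t.2.1 = hy ∨ t.2.1 = dy ∨ t.2.1 = dy') := by
    intro t ht
    constructor
    · by_contra h
      push Not at h
      exact hLLx t ht (hxl t.1 h.1 h.2.1 h.2.2)
    · by_contra h
      push Not at h
      exact hLLy t ht (hyl t.2.1 h.1 h.2.1 h.2.2)
  -- (2x) at most two triangles through an x-deuce
  have h2x : ∀ δ, δ = dx ∨ δ = dx' → #{t ∈ Tri | t.1 = δ} ≤ 2 := by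
    intro δ hδ
    obtain ⟨hδy, hδw⟩ := hxd δ hδ
    by_contra hlt
    rw [not_le] at hlt
    -- pigeonhole on the y-vertex: two distinct triangles through δ share their y-vertex β
    have hmaps : Set.MapsTo (fun t : X × Y × W => (t.1, t.2.1)) ({t ∈ Tri | t.1 = δ} : Finset _)
        ({e ∈ Exy | e.1 = δ} : Finset _) := by
      intro t ht
      have ht' := mem_filter.1 (mem_coe.1 ht)
      exact mem_coe.2 (mem_filter.2 ⟨((hTri t).1 ht'.1).1, ht'.2⟩)
    obtain ⟨t, ht, t', ht', hne, hββ⟩ :=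
      exists_ne_map_eq_of_card_lt_of_maps_to (lt_of_le_of_lt hδy hlt) hmaps
    rw [mem_filter] at ht ht'
    obtain ⟨hxy, hxw, hyw⟩ := (hTri t).1 ht.1
    obtain ⟨-, hxw', hyw'⟩ := (hTri t').1 ht'.1
    simp only [Prod.mk.injEq] at hββ
    have hγne : t.2.2 ≠ t'.2.2 := by
      intro h
      exact hne (Prod.ext hββ.1 (Prod.ext hββ.2 h))
    obtain ⟨γ, hγ, hβγ⟩ := hDx t.1 t.2.1 hxy
    have hγ1 : γ ≠ t.2.2 := fun h => hβγ (h ▸ hyw)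
    have hγ2 : γ ≠ t'.2.2 := fun h => hβγ (by rw [h, hββ.2]; exact hyw')
    have h3 : 2 < #{e ∈ Exw | e.1 = δ} := by
      rw [two_lt_card]
      refine ⟨(t.1, γ), mem_filter.2 ⟨hγ, ht.2⟩, (t.1, t.2.2), mem_filter.2 ⟨hxw, ht.2⟩,
        (t'.1, t'.2.2), mem_filter.2 ⟨hxw', ht'.2⟩, ?_, ?_, ?_⟩
      · intro h; have h' := congrArg Prod.snd h; exact hγ1 h'
      · intro h; have h' := congrArg Prod.snd h; exact hγ2 h'
      · intro h; have h' := congrArg Prod.snd h; exact hγne h'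
    omega
  -- (2y) distinct x-vertices among the triangles through a y-deuce
  have h2y : ∀ δ, δ = dy ∨ δ = dy' →
      ∀ t ∈ Tri, ∀ t' ∈ Tri, t.2.1 = δ → t'.2.1 = δ → t.1 = t'.1 → t = t' := by
    intro δ hδ t ht t' ht' htδ ht'δ hαα
    have hδw := hyd δ hδ
    by_contra hne
    obtain ⟨hxy, hxw, hyw⟩ := (hTri t).1 ht
    obtain ⟨-, hxw', hyw'⟩ := (hTri t').1 ht'
    have hγne : t.2.2 ≠ t'.2.2 := by
      intro h
      exact hne (Prod.ext hαα (Prod.ext (htδ.trans ht'δ.symm) h))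
    obtain ⟨γ, hγ, hαγ⟩ := hDy t.1 t.2.1 hxy
    have hγ1 : γ ≠ t.2.2 := fun h => hαγ (h ▸ hxw)
    have hγ2 : γ ≠ t'.2.2 := fun h => hαγ (by rw [h, hαα]; exact hxw')
    have h3 : 2 < #{e ∈ Eyw | e.1 = δ} := by
      rw [two_lt_card]
      refine ⟨(t.2.1, γ), mem_filter.2 ⟨hγ, htδ⟩, (t.2.1, t.2.2), mem_filter.2 ⟨hyw, htδ⟩,
        (t'.2.1, t'.2.2), mem_filter.2 ⟨hyw', ht'δ⟩, ?_, ?_, ?_⟩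
      · intro h; have h' := congrArg Prod.snd h; exact hγ1 h'
      · intro h; have h' := congrArg Prod.snd h; exact hγ2 h'
      · intro h; have h' := congrArg Prod.snd h; exact hγne h'
    omega
  exact card_triangles_le_six_add Tri hx dx dx' hy dy dy' hheavy h2x h2y

end Triangles

end Summit.Ventures.HSemireg.StarFamilyTriangleBudget
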